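import Literature.Probability.RandomPlanarGeometry.SelfAvoidingWalk
import Literature.Probability.Percolation.FourArmGarbanSquareDomain
import Mathlib.Analysis.Complex.ReImTopology
import Mathlib.Analysis.Normed.Module.RCLike.Real
import HarnessLib

/-!
# Cell domains and their discretisation — support file for `stub_sawDomainMarkov`
(line `capacity-clock-no-plateau` of the crux `SAWLoopFugacityFlow.SimpleSubseqLimits`,
stmt-CriticalPhenomena-4982, STUB 3c; registered skeleton
`Summits/CriticalPhenomena/SAWScalingLimit/Cruxes/SimpleSubseqLimits/CapacityClockNoPlateau`)

The square-cell domain `U(S, δ)` of a finite vertex set `S ⊆ ℤ²` (Kemppainen–Smirnov 2017, §4.1.6: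
the interior of the union of the closed `δ`-squares centred at the mesh points of `S`) and its
canonical discretisation `discreteDomainGraph (U(S, δ)) δ` (`DomainDiscretisation.lean`):

* `cellDomain`, `remainingVerts` — VERBATIM copies of the registered skeleton's definitions
  (namespace `…Cruxes.SimpleSubseqLimits.CapacityClockNoPlateau`), so that the lead's statement
  `SAWDomainMarkov` agrees definitionally with the one proved in
  `…StubDomainMarkov.lean`;
* `meshVertices_cellDomain` — the mesh vertices of `U(S, δ)` are exactly `S` (`δ > 0`);
* `segment_subset_closure_cellDomain` — closed lattice edges between neighbours of `S` lie in
  `cl U(S, δ)`, so the mesh graph restricted to `S` is the nearest-neighbour graph;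
* `cellGraph_adj_iff` — for `S` connected in `ℤ²`, `discreteDomainGraph (U(S, δ)) δ` is the
  subgraph of `ℤ²` INDUCED on `S` (the largest-component convention `meshDomain` returns `S`);
* `remainingVerts_preconnected`, `remGraph_adj_iff`, `remGraph_le` — the remaining vertex set
  `remainingVerts S P t` (vertices of `S` joined to the tip `t` inside `S ∖ P`) is connected
  through `t`, so the same description applies to the remaining cell domain, a subgraph of the
  original one.

Elementary (closed squares as `closedBall ×ℂ closedBall`, `Complex.closure_reProdIm`; the
largest-component computation is the percolation library's
`meshDomain_eq_meshVertices_of_preconnected`); no named facts. Sources: A. Kemppainen, S. Smirnov, *Random curves, scaling limits and Loewner evolutions*,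
Ann. Probab. 45 (2017), §4.1.6; S. Smirnov (2001), §2 (largest-component convention).
-/

noncomputable section

open MeasureTheory Filter Topology Set
open Literature.Probability.RandomPlanarGeometry Literature.Probability.LatticeModels
open scoped ENNReal NNReal unitInterval

namespace Summit.CriticalPhenomena.SAWScalingLimit.Theorems.SimpleSubseqLimits.CapacityClock.DomainMarkov

/-- The plain **square-cell domain** `U(S, δ)` of a finite vertex set `S ⊆ ℤ²` at mesh `δ`: the
interior of the union of the closed `δ`-squares centred at the mesh points of `S` — VERBATIM the
inline domain of `SAWParafermion.KSAdmissibleG1` (stmt-11346; Kemppainen–Smirnov §4.1.6) and a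
VERBATIM copy of the registered skeleton's `cellDomain`. Its discretisation
`discreteDomainGraph (cellDomain S δ) δ` is the subgraph of `ℤ²` induced on `S` when `S` is
connected (`cellGraph_adj_iff`). [folklore] -/
def cellDomain (S : Finset (Site 2)) (δ : ℝ) : Set ℂ :=
  interior (⋃ v ∈ S, {z : ℂ | |z.re - (meshPoint δ v).re| ≤ δ / 2 ∧ |z.im - (meshPoint δ v).im| ≤ δ / 2})

open scoped Classical in
/-- The **remaining vertex set** after an explored prefix: the vertices of `S` joined to the tip
`t` by a lattice path inside `S` avoiding the deleted set `P` (Kemppainen–Smirnov §4.1.6: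
`U_t = {tip} ∪ comp_b`; dead pockets cut off by the prefix are discarded, which does not change
the law of the future). VERBATIM copy of the registered skeleton's `remainingVerts`. [folklore] -/
def remainingVerts (S P : Finset (Site 2)) (t : Site 2) : Finset (Site 2) :=
  S.filter fun w => ∃ q : (zdGraph 2).Walk t w, ∀ x ∈ q.support, x ∈ S ∧ x ∉ P

/-! ### Cells -/

variable {S : Finset (Site 2)} {δ : ℝ}

/-- The closed `δ`-cell of `v` is the product of two closed intervals. [folklore] -/
theorem cell_eq (δ : ℝ) (v : Site 2) :
    {z : ℂ | |z.re - (meshPoint δ v).re| ≤ δ / 2 ∧ |z.im - (meshPoint δ v).im| ≤ δ / 2} =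
      Metric.closedBall (meshPoint δ v).re (δ / 2) ×ℂ
        Metric.closedBall (meshPoint δ v).im (δ / 2) := by
  ext z
  simp [Complex.mem_reProdIm, Metric.mem_closedBall, Real.dist_eq]

/-- The open `δ`-cell of a vertex of `S` lies in the cell domain `U(S, δ)`. [folklore] -/
theorem openCell_subset_cellDomain {v : Site 2} (hv : v ∈ S) :
    Metric.ball (meshPoint δ v).re (δ / 2) ×ℂ Metric.ball (meshPoint δ v).im (δ / 2) ⊆
      cellDomain S δ := by
  refine interior_maximal ?_ (Metric.isOpen_ball.reProdIm Metric.isOpen_ball)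
  intro z hz
  simp only [mem_iUnion]
  refine ⟨v, hv, ?_⟩
  rw [cell_eq]
  exact ⟨Metric.ball_subset_closedBall hz.1, Metric.ball_subset_closedBall hz.2⟩

/-- The mesh point of a vertex of `S` lies in `U(S, δ)` (`δ > 0`). [folklore] -/
theorem meshPoint_mem_cellDomain (hδ : 0 < δ) {v : Site 2} (hv : v ∈ S) :
    meshPoint δ v ∈ cellDomain S δ :=
  openCell_subset_cellDomain hv
    ⟨Metric.mem_ball_self (half_pos hδ), Metric.mem_ball_self (half_pos hδ)⟩

/-- Distinct lattice sites have mesh points in distinct closed cells (`δ > 0`). [folklore] -/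
theorem eq_of_meshPoint_mem_cell (hδ : 0 < δ) {v w : Site 2}
    (h : meshPoint δ v ∈
      {z : ℂ | |z.re - (meshPoint δ w).re| ≤ δ / 2 ∧ |z.im - (meshPoint δ w).im| ≤ δ / 2}) :
    v = w := by
  simp only [mem_setOf_eq, meshPoint_re, meshPoint_im, ← mul_sub, abs_mul, abs_of_pos hδ] at h
  have key : ∀ m n : ℤ, δ * |((m : ℝ) - n)| ≤ δ / 2 → m = n := by
    intro m n hmn
    have h1 : |((m : ℝ) - n)| ≤ 1 / 2 := by nlinarith
    have h2 : |((m - n : ℤ) : ℝ)| < 1 := by push_cast; linarith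
    rw [← Int.cast_abs, ← Int.cast_one, Int.cast_lt, Int.abs_lt_one_iff, sub_eq_zero] at h2
    exact h2
  funext i
  fin_cases i
  · exact key _ _ h.1
  · exact key _ _ h.2

/-- The mesh vertices of the cell domain `U(S, δ)` are exactly `S` (`δ > 0`). [folklore] -/
theorem meshVertices_cellDomain (hδ : 0 < δ) (S : Finset (Site 2)) :
    meshVertices (cellDomain S δ) δ = ↑S := by
  ext v
  simp only [mem_meshVertices_iff, Finset.mem_coe]
  constructor
  · intro h
    have h' := interior_subset h
    simp only [mem_iUnion] at h'
    obtain ⟨w, hw, hvw⟩ := h'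
    rwa [eq_of_meshPoint_mem_cell hδ hvw]
  · exact meshPoint_mem_cellDomain hδ

/-- The closed cell of a vertex of `S` lies in the closure of `U(S, δ)` (`δ > 0`). [folklore] -/
theorem cell_subset_closure_cellDomain (hδ : 0 < δ) {v : Site 2} (hv : v ∈ S) :
    {z : ℂ | |z.re - (meshPoint δ v).re| ≤ δ / 2 ∧ |z.im - (meshPoint δ v).im| ≤ δ / 2} ⊆
      closure (cellDomain S δ) := by
  refine Subset.trans ?_ (closure_mono (openCell_subset_cellDomain hv))
  rw [cell_eq, Complex.closure_reProdIm, closure_ball _ (half_pos hδ).ne',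
    closure_ball _ (half_pos hδ).ne']

/-- The closed lattice edge between two `ℤ²`-neighbours of `S` lies in the closure of `U(S, δ)`.
[folklore] -/
theorem segment_subset_closure_cellDomain (hδ : 0 < δ) {x y : Site 2} (hx : x ∈ S) (hy : y ∈ S)
    (hxy : (zdGraph 2).Adj x y) :
    segment ℝ (meshPoint δ x) (meshPoint δ y) ⊆ closure (cellDomain S δ) := by
  rintro z ⟨a', b', ha, hb, hab, rfl⟩
  -- coordinates of `ℤ²`-neighbours differ by at most one
  have hcoord : ∀ j : Fin 2, |((y j : ℤ) : ℝ) - x j| ≤ 1 := by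
    intro j
    rw [← Int.cast_sub, ← Int.cast_abs, ← Int.cast_one, Int.cast_le]
    obtain ⟨i, h | h⟩ := (zdGraph_adj_iff x y).1 hxy
    · rw [h, Pi.add_apply, add_sub_cancel_left, Pi.single_apply]
      split_ifs <;> simp
    · rw [h, Pi.add_apply, sub_add_cancel_left, abs_neg, Pi.single_apply]
      split_ifs <;> simp
  have h0 := hcoord 0
  have h1 := hcoord 1
  have hre : (a' • meshPoint δ x + b' • meshPoint δ y).re - (meshPoint δ x).re =
      b' * (δ * (((y 0 : ℤ) : ℝ) - x 0)) := by
    simp only [Complex.add_re, Complex.smul_re, meshPoint_re, smul_eq_mul]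
    linear_combination (δ * ((x 0 : ℤ) : ℝ)) * hab
  have him : (a' • meshPoint δ x + b' • meshPoint δ y).im - (meshPoint δ x).im =
      b' * (δ * (((y 1 : ℤ) : ℝ) - x 1)) := by
    simp only [Complex.add_im, Complex.smul_im, meshPoint_im, smul_eq_mul]
    linear_combination (δ * ((x 1 : ℤ) : ℝ)) * hab
  have hre' : (a' • meshPoint δ x + b' • meshPoint δ y).re - (meshPoint δ y).re =
      a' * (δ * (((x 0 : ℤ) : ℝ) - y 0)) := by
    simp only [Complex.add_re, Complex.smul_re, meshPoint_re, smul_eq_mul]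
    linear_combination (δ * ((y 0 : ℤ) : ℝ)) * hab
  have him' : (a' • meshPoint δ x + b' • meshPoint δ y).im - (meshPoint δ y).im =
      a' * (δ * (((x 1 : ℤ) : ℝ) - y 1)) := by
    simp only [Complex.add_im, Complex.smul_im, meshPoint_im, smul_eq_mul]
    linear_combination (δ * ((y 1 : ℤ) : ℝ)) * hab
  have key : ∀ {c d : ℝ}, 0 ≤ c → c ≤ 1 / 2 → |d| ≤ 1 → |c * (δ * d)| ≤ δ / 2 := by
    intro c d hc hc2 hd
    rw [abs_mul, abs_mul, abs_of_nonneg hc, abs_of_pos hδ]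
    have h1 : δ * |d| ≤ δ := by nlinarith [abs_nonneg d]
    calc c * (δ * |d|) ≤ c * δ := mul_le_mul_of_nonneg_left h1 hc
      _ ≤ (1 / 2) * δ := mul_le_mul_of_nonneg_right hc2 hδ.le
      _ = δ / 2 := by ring
  rcases le_total b' (1 / 2) with hb2 | hb2
  · refine cell_subset_closure_cellDomain hδ hx ⟨?_, ?_⟩
    · rw [hre]; exact key hb hb2 h0
    · rw [him]; exact key hb hb2 h1
  · have ha2 : a' ≤ 1 / 2 := by linarith
    refine cell_subset_closure_cellDomain hδ hy ⟨?_, ?_⟩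
    · rw [hre']; exact key ha ha2 (by rw [abs_sub_comm]; exact h0)
    · rw [him']; exact key ha ha2 (by rw [abs_sub_comm]; exact h1)

/-! ### The discretisation of a cell domain -/

/-- Between vertices of `S`, the mesh graph of `U(S, δ)` is the nearest-neighbour graph `ℤ²`.
[folklore] -/
theorem meshGraph_cellDomain_adj_iff (hδ : 0 < δ) {x y : Site 2} (hx : x ∈ S) (hy : y ∈ S) :
    (meshGraph (cellDomain S δ) δ).Adj x y ↔ (zdGraph 2).Adj x y := by
  rw [meshGraph_adj_iff]
  exact ⟨fun h => h.1, fun h => ⟨h, segment_subset_closure_cellDomain hδ hx hy h⟩⟩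

/-- If `S` is connected in `ℤ²`, the mesh-vertex graph of `U(S, δ)` is preconnected. [folklore] -/
theorem meshVertexGraph_cellDomain_preconnected (hδ : 0 < δ)
    (hS : ((zdGraph 2).induce (↑S : Set (Site 2))).Preconnected) :
    (meshVertexGraph (cellDomain S δ) δ).Preconnected := by
  have hV := meshVertices_cellDomain hδ S
  -- the identity map `S → meshVertices` is a graph homomorphism
  let f : (zdGraph 2).induce (↑S : Set (Site 2)) →g meshVertexGraph (cellDomain S δ) δ :=
    { toFun := fun v => ⟨v.1, by rw [hV]; exact v.2⟩
      map_rel' := by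
        intro v w h
        rw [SimpleGraph.induce_adj] at h ⊢
        exact (meshGraph_cellDomain_adj_iff hδ v.2 w.2).2 h }
  intro u w
  have hu : (u : Site 2) ∈ (↑S : Set (Site 2)) := by rw [← hV]; exact u.2
  have hw : (w : Site 2) ∈ (↑S : Set (Site 2)) := by rw [← hV]; exact w.2
  have h := (hS ⟨u, hu⟩ ⟨w, hw⟩).map f
  exact h

/-- If `S` is connected in `ℤ²`, the discrete domain of `U(S, δ)` is `S` (largest-component
convention, via `Literature.Probability.Percolation.meshDomain_eq_meshVertices_of_preconnected`).
[folklore] -/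
theorem meshDomain_cellDomain (hδ : 0 < δ)
    (hS : ((zdGraph 2).induce (↑S : Set (Site 2))).Preconnected) :
    meshDomain (cellDomain S δ) δ = ↑S := by
  rw [Literature.Probability.Percolation.meshDomain_eq_meshVertices_of_preconnected
      (meshVertexGraph_cellDomain_preconnected hδ hS),
    meshVertices_cellDomain hδ]

/-- **The discretisation of a connected cell domain is the induced subgraph of `ℤ²`**:
`Ω_δ`-adjacency in `U(S, δ)` is `ℤ²`-adjacency between vertices of `S`. [folklore] -/
theorem cellGraph_adj_iff (hδ : 0 < δ)
    (hS : ((zdGraph 2).induce (↑S : Set (Site 2))).Preconnected) {x y : Site 2} :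
    (discreteDomainGraph (cellDomain S δ) δ).Adj x y ↔ (zdGraph 2).Adj x y ∧ x ∈ S ∧ y ∈ S := by
  rw [discreteDomainGraph_adj_iff, meshDomain_cellDomain hδ hS, Finset.mem_coe, Finset.mem_coe]
  constructor
  · rintro ⟨h, hx, hy⟩
    exact ⟨(meshGraph_cellDomain_adj_iff hδ hx hy).1 h, hx, hy⟩
  · rintro ⟨h, hx, hy⟩
    exact ⟨(meshGraph_cellDomain_adj_iff hδ hx hy).2 h, hx, hy⟩

/-! ### The remaining vertex set -/

variable {P : Finset (Site 2)} {t : Site 2}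

/-- Membership in `remainingVerts`, unfolded. [folklore] -/
theorem mem_remainingVerts {w : Site 2} :
    w ∈ remainingVerts S P t ↔
      w ∈ S ∧ ∃ q : (zdGraph 2).Walk t w, ∀ x ∈ q.support, x ∈ S ∧ x ∉ P := by
  classical
  exact Finset.mem_filter

/-- A lattice walk from the tip inside `S ∖ P` ends in the remaining vertex set. [folklore] -/
theorem mem_remainingVerts_of_walk {w : Site 2} (q : (zdGraph 2).Walk t w)
    (hq : ∀ x ∈ q.support, x ∈ S ∧ x ∉ P) : w ∈ remainingVerts S P t :=
  mem_remainingVerts.2 ⟨(hq w q.end_mem_support).1, q, hq⟩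

/-- Every vertex of a lattice walk from the tip inside `S ∖ P` is a remaining vertex. [folklore] -/
theorem mem_remainingVerts_of_mem_support {w : Site 2} (q : (zdGraph 2).Walk t w)
    (hq : ∀ x ∈ q.support, x ∈ S ∧ x ∉ P) {x : Site 2} (hx : x ∈ q.support) :
    x ∈ remainingVerts S P t := by
  classical
  exact mem_remainingVerts_of_walk (q.takeUntil x hx)
    fun y hy => hq y (q.support_takeUntil_subset_support hx hy)

/-- Remaining vertices lie in `S` and avoid `P`. [folklore] -/
theorem mem_and_not_mem_of_mem_remainingVerts {w : Site 2} (hw : w ∈ remainingVerts S P t) :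
    w ∈ S ∧ w ∉ P := by
  obtain ⟨-, q, hq⟩ := mem_remainingVerts.1 hw
  exact hq w q.end_mem_support

/-- The remaining vertex set is connected in `ℤ²` (through the tip). [folklore] -/
theorem remainingVerts_preconnected :
    ((zdGraph 2).induce (↑(remainingVerts S P t) : Set (Site 2))).Preconnected := by
  have key : ∀ w (hw : w ∈ (↑(remainingVerts S P t) : Set (Site 2))),
      ∃ ht : t ∈ (↑(remainingVerts S P t) : Set (Site 2)),
        ((zdGraph 2).induce (↑(remainingVerts S P t) : Set (Site 2))).Reachable
          ⟨t, ht⟩ ⟨w, hw⟩ := by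
    intro w hw
    obtain ⟨-, q, hq⟩ := mem_remainingVerts.1 hw
    have hsub : ∀ x ∈ q.support, x ∈ (↑(remainingVerts S P t) : Set (Site 2)) :=
      fun x hx => mem_remainingVerts_of_mem_support q hq hx
    exact ⟨hsub t q.start_mem_support, ⟨q.induce _ hsub⟩⟩
  rintro ⟨u, hu⟩ ⟨w, hw⟩
  obtain ⟨ht, hu'⟩ := key u hu
  obtain ⟨ht', hw'⟩ := key w hw
  exact hu'.symm.trans hw'

/-- `Ω_δ`-adjacency in the remaining cell domain `U(R, δ)`, `R = remainingVerts S P t`.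
[folklore] -/
theorem remGraph_adj_iff (hδ : 0 < δ) {x y : Site 2} :
    (discreteDomainGraph (cellDomain (remainingVerts S P t) δ) δ).Adj x y ↔
      (zdGraph 2).Adj x y ∧ x ∈ remainingVerts S P t ∧ y ∈ remainingVerts S P t :=
  cellGraph_adj_iff hδ remainingVerts_preconnected

/-- The remaining discrete domain is a subgraph of the original one. [folklore] -/
theorem remGraph_le (hδ : 0 < δ) (hS : ((zdGraph 2).induce (↑S : Set (Site 2))).Preconnected) :
    discreteDomainGraph (cellDomain (remainingVerts S P t) δ) δ ≤
      discreteDomainGraph (cellDomain S δ) δ := by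
  intro x y h
  rw [remGraph_adj_iff hδ] at h
  rw [cellGraph_adj_iff hδ hS]
  exact ⟨h.1, (mem_and_not_mem_of_mem_remainingVerts h.2.1).1,
    (mem_and_not_mem_of_mem_remainingVerts h.2.2).1⟩

/-- **Registered support stub `stub_sawDomainMarkov_cells` of `stub_sawDomainMarkov`**: the
discretisation of a connected cell domain `U(S, δ)` is the subgraph of `ℤ²` induced on `S`
(`cellGraph_adj_iff`, closed form). [folklore] -/
theorem stub_sawDomainMarkov_cells :
    ∀ (S : Finset (Site 2)) (δ : ℝ), 0 < δ → ((zdGraph 2).induce (↑S : Set (Site 2))).Preconnected →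
      ∀ x y : Site 2, (discreteDomainGraph (cellDomain S δ) δ).Adj x y ↔
        ((zdGraph 2).Adj x y ∧ x ∈ S ∧ y ∈ S) :=
  fun _ _ hδ hS _ _ => cellGraph_adj_iff hδ hS

end Summit.CriticalPhenomena.SAWScalingLimit.Theorems.SimpleSubseqLimits.CapacityClock.DomainMarkov
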